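import Literature.AlgebraicGeometry.Resolution.QuadraticTransformsStructure
import Mathlib.RingTheory.LocalRing.ResidueField.Basic

/-!
# Reduction of a quadratic sequence modulo a followed branch (Herrmann–Ikeda–Orbanz (30.2) (b))

Helper file for the stub `stub_curveMonomialization` of the line `pfaff-line-log-final-forms`
(crux `Valuative.LuAlphaPTorsor`, item `stmt-ResolutionOfSingularities-0641`).

Let `O ⊆ W` be valuation rings of `K` (`W` a coarsening of `O`), `κ = W/𝔪_W` the residue field
of `W` and `π : W → κ` the residue map. The images `π(S ∩ W)` of subrings `S ⊆ W` are subrings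
of `κ`; `π(O)` is a valuation ring `O''` of `κ` (`exists_residue_valuationSubring`), and for
`z ∈ O`: `z` is a unit of `O` iff `π(z)` is a unit of `O''` (`residue_valuation_eq_one_iff`).
PROVED, for a local subring `R ⊆ O` NOT dominated by `W` (so that `𝔪_W ∩ R ⊊ 𝔪_R`):

* `residue_closure`, `residue_locAtCentre` — `π` commutes with generating subrings and with
  localising at the centre of `O` (the two halves of Herrmann–Ikeda–Orbanz, proof of
  Thm. (30.2), b): "`R^{(j)}/𝔭^{(j)}` is a quadratic transform of `R̄^{(j-1)}`", assembled in the
  sequel `…CurveMonomializationReduction.lean`);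
* `subringDominates_residue`, `isLocalRingOf_residue`, `isNoetherianRing_residue`,
  `ringKrullDim_residue_le_one` — `π(R)` is dominated by `O''` when `R` is dominated by `O`; it
  is a local ring of `κ` when `W = R_𝔮` consists of fractions with denominators of value zero;
  it is Noetherian of dimension `≤ dim R - 1` for `R` Noetherian.

All [folklore] (Zariski–Samuel II, Ch. VI §§8–10, composite valuations).
-/

set_option linter.dupNamespace false

namespace Summit.ResolutionOfSingularities.ResolutionOfSingularities.Theorems.PfaffLine.CurveMono

open IsLocalRing Literature.AlgebraicGeometry.Resolution

variable {K : Type} [Field K]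

/-! ## The valuation ring `π(O)` of the residue field of a coarsening `W ⊇ O` -/

/-- **The image of `O` in the residue field of a coarsening `W ⊇ O` is a valuation ring** of
`κ(W)`: for `z ∈ W`, `z ∈ O` or `z⁻¹ ∈ O`, and `π(z⁻¹) = π(z)⁻¹`. [folklore] -/
theorem exists_residue_valuationSubring {O W : ValuationSubring K} (hOW : O ≤ W) :
    ∃ O'' : ValuationSubring (ResidueField W),
      O''.toSubring = (O.toSubring.comap W.subtype).map (residue W) := by
  refine ⟨ValuationSubring.ofSubring _ fun ℓ => ?_, rfl⟩
  obtain ⟨w, rfl⟩ := IsLocalRing.residue_surjective ℓ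
  by_cases hw : (w : K) ∈ O
  · exact Or.inl ⟨w, hw, rfl⟩
  · right
    have hwinv : (w : K)⁻¹ ∈ O := (O.mem_or_inv_mem _).resolve_left hw
    have hw0 : (w : K) ≠ 0 := fun h => hw (h ▸ O.zero_mem)
    have hwinvW : (w : K)⁻¹ ∈ W := hOW hwinv
    refine ⟨⟨(w : K)⁻¹, hwinvW⟩, hwinv, ?_⟩
    have hmul : w * ⟨(w : K)⁻¹, hwinvW⟩ = 1 := Subtype.ext (mul_inv_cancel₀ hw0)
    symm
    exact inv_eq_of_mul_eq_one_right (by rw [← map_mul (residue W), hmul, map_one])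

section Residue

variable {O W : ValuationSubring K} (hOW : O ≤ W) {O'' : ValuationSubring (ResidueField W)}
  (hO'' : O''.toSubring = (O.toSubring.comap W.subtype).map (residue W))

include hO'' in
/-- `π(z) ∈ O''` for `z ∈ O`. [folklore] -/
theorem residue_mem {z : W} (hz : (z : K) ∈ O) : residue W z ∈ O'' := by
  change residue W z ∈ O''.toSubring
  rw [hO'']
  exact ⟨z, hz, rfl⟩

include hO'' in
/-- Every element of `O''` is `π(z)` for some `z ∈ O`. [folklore] -/
theorem exists_of_mem_residue {ℓ : ResidueField W} (hℓ : ℓ ∈ O'') :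
    ∃ z : W, (z : K) ∈ O ∧ residue W z = ℓ := by
  change ℓ ∈ O''.toSubring at hℓ
  rw [hO''] at hℓ
  obtain ⟨z, hz, rfl⟩ := hℓ
  exact ⟨z, hz, rfl⟩

/-- `π(z) ≠ 0` iff `w(z) = 0` (`W.valuation z = 1`). [folklore] -/
theorem residue_ne_zero_iff (z : W) : residue W z ≠ 0 ↔ W.valuation (z : K) = 1 := by
  rw [IsLocalRing.residue_ne_zero_iff_isUnit, ValuationSubring.valuation_eq_one_iff]

include hOW hO'' in
/-- **`π` detects the units of `O`**: for `z ∈ O`, `π(z)` is a unit of `O''` iff `z` is a unit of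
`O` (as `𝔪_W ⊆ 𝔪_O`, `1 + 𝔪_W` consists of units of `O`). [folklore] -/
theorem residue_valuation_eq_one_iff {z : W} (hz : (z : K) ∈ O) :
    O''.valuation (residue W z) = 1 ↔ O.valuation (z : K) = 1 := by
  have hmem : residue W z ∈ O'' := residue_mem hO'' hz
  constructor
  · intro h1
    -- `π(z)⁻¹ = π(t)` with `t ∈ O`, so `z t ∈ 1 + 𝔪_W` is a unit of `O`
    have hinv : (residue W z)⁻¹ ∈ O'' := by
      rw [← O''.valuation_le_one_iff, map_inv₀, h1, inv_one]
    obtain ⟨t, ht, hte⟩ := exists_of_mem_residue hO'' hinv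
    have hz0 : residue W z ≠ 0 := by
      intro h0; rw [h0, map_zero] at h1; exact zero_ne_one h1
    have hzt : residue W (z * t - 1) = 0 := by
      rw [map_sub, map_mul, hte, mul_inv_cancel₀ hz0, map_one, sub_self]
    rw [IsLocalRing.residue_eq_zero_iff, ValuationSubring.valuation_lt_one_iff] at hzt
    have hzt' : O.valuation (((z * t - 1 : W) : K)) < 1 :=
      (ValuationSubring.mem_nonunits_iff _).mp ((ValuationSubring.nonunits_le_nonunits.mpr hOW)
        ((ValuationSubring.mem_nonunits_iff _).mpr hzt))
    have hone : O.valuation ((z : K) * t) = 1 := by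
      have e : (z : K) * t = 1 + ((z * t - 1 : W) : K) := by push_cast; ring
      rw [e]
      exact Valuation.map_one_add_of_lt _ hzt'
    rw [map_mul] at hone
    have hzle : O.valuation (z : K) ≤ 1 := (O.valuation_le_one_iff _).mpr hz
    have htle : O.valuation (t : K) ≤ 1 := (O.valuation_le_one_iff _).mpr ht
    refine le_antisymm hzle ?_
    by_contra hlt
    rw [not_le] at hlt
    have : O.valuation (z : K) * O.valuation (t : K) < 1 * 1 :=
      mul_lt_mul_of_lt_of_le_of_nonneg_of_pos hlt htle zero_le zero_lt_one
    rw [hone, one_mul] at this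
    exact lt_irrefl _ this
  · intro h1
    -- `z⁻¹ ∈ O`, so `π(z)⁻¹ = π(z⁻¹) ∈ O''`
    have hz0 : (z : K) ≠ 0 := ne_zero_of_valuation_eq_one h1
    have hzinv : (z : K)⁻¹ ∈ O := by rw [← O.valuation_le_one_iff, map_inv₀, h1, inv_one]
    have hzinvW : (z : K)⁻¹ ∈ W := hOW hzinv
    have hmul : z * ⟨(z : K)⁻¹, hzinvW⟩ = 1 := Subtype.ext (mul_inv_cancel₀ hz0)
    have hres0 : residue W z ≠ 0 := by
      intro h0
      have h1' : residue W z * residue W ⟨(z : K)⁻¹, hzinvW⟩ = 1 := by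
        rw [← map_mul (residue W), hmul, map_one]
      rw [h0, zero_mul] at h1'
      exact zero_ne_one h1'
    have hinvmem : (residue W z)⁻¹ ∈ O'' := by
      have e : (residue W z)⁻¹ = residue W ⟨(z : K)⁻¹, hzinvW⟩ :=
        inv_eq_of_mul_eq_one_right (by rw [← map_mul (residue W), hmul, map_one])
      rw [e]
      exact residue_mem hO'' hzinv
    refine le_antisymm ((O''.valuation_le_one_iff _).mpr hmem) ?_
    have h2 : O''.valuation (residue W z)⁻¹ ≤ 1 := (O''.valuation_le_one_iff _).mpr hinvmem
    rwa [map_inv₀, inv_le_one₀ (pos_iff_ne_zero.mpr ((map_ne_zero _).mpr hres0))] at h2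

include hOW hO'' in
/-- The `< 1` form: for `z ∈ O`, `π(z) ∈ 𝔪_{O''}` iff `z ∈ 𝔪_O`. [folklore] -/
theorem residue_valuation_lt_one_iff {z : W} (hz : (z : K) ∈ O) :
    O''.valuation (residue W z) < 1 ↔ O.valuation (z : K) < 1 := by
  have h1 : O''.valuation (residue W z) ≤ 1 := (O''.valuation_le_one_iff _).mpr (residue_mem hO'' hz)
  have h2 : O.valuation (z : K) ≤ 1 := (O.valuation_le_one_iff _).mpr hz
  rw [h1.lt_iff_ne, h2.lt_iff_ne, not_iff_not, residue_valuation_eq_one_iff hOW hO'' hz]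

end Residue

/-! ## `π` and fractions -/

/-- `π(y/z) = π(y)/π(z)` for `y, z ∈ W` with `w(z) = 0`, and `π(z) ≠ 0`. [folklore] -/
theorem residue_div {W : ValuationSubring K} {y z : K} (hy : y ∈ W) (hz : z ∈ W)
    (hvz : W.valuation z = 1) :
    ∃ h : y / z ∈ W, residue W ⟨y / z, h⟩ = residue W ⟨y, hy⟩ / residue W ⟨z, hz⟩ ∧
      residue W ⟨z, hz⟩ ≠ 0 := by
  have hz0 : z ≠ 0 := ne_zero_of_valuation_eq_one hvz
  have hzinv : z⁻¹ ∈ W := by rw [← W.valuation_le_one_iff, map_inv₀, hvz, inv_one]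
  have h : y / z ∈ W := by rw [div_eq_mul_inv]; exact W.mul_mem _ _ hy hzinv
  have hres0 : residue W ⟨z, hz⟩ ≠ 0 := (residue_ne_zero_iff ⟨z, hz⟩).mpr hvz
  refine ⟨h, ?_, hres0⟩
  rw [eq_div_iff hres0, ← map_mul]
  congr 1
  exact Subtype.ext (div_mul_cancel₀ y hz0)

/-! ## Images of subrings of `W` in the residue field -/

section Image

variable {O W : ValuationSubring K} (hOW : O ≤ W) {O'' : ValuationSubring (ResidueField W)}
  (hO'' : O''.toSubring = (O.toSubring.comap W.subtype).map (residue W))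

/-- **`π` commutes with generating subrings**: `π(⟨s⟩ ∩ W) = ⟨π(s)⟩` for `s ⊆ W`. [folklore] -/
theorem residue_closure {s : Set K} (hs : s ⊆ W) :
    ((Subring.closure s).comap W.subtype).map (residue W) =
      Subring.closure (residue W '' (W.subtype ⁻¹' s)) := by
  have h1 : Subring.closure s = (Subring.closure (W.subtype ⁻¹' s)).map W.subtype := by
    rw [RingHom.map_closure, Set.image_preimage_eq_of_subset]
    intro x hx
    exact ⟨⟨x, hs hx⟩, rfl⟩
  rw [h1, Subring.comap_map_eq_self_of_injective Subtype.val_injective, RingHom.map_closure]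

include hOW hO'' in
/-- **`π` commutes with localising at the centre**: `π(C_{𝔪_O ∩ C}) = π(C)_{𝔪_{O''} ∩ π(C)}` for
`C ⊆ O`. [folklore] -/
theorem residue_locAtCentre {C : Subring K} (hC : C ≤ O.toSubring) :
    ((locAtCentre C O).comap W.subtype).map (residue W) =
      locAtCentre ((C.comap W.subtype).map (residue W)) O'' := by
  have hCW : C ≤ W.toSubring := fun x hx => hOW (hC hx)
  ext ℓ
  constructor
  · rintro ⟨w, hw, rfl⟩
    obtain ⟨y, hy, z, hz, hvz, hwe⟩ := (mem_locAtCentre_iff).mp hw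
    have hzW : z ∈ W := hCW hz
    have hyW : y ∈ W := hCW hy
    have hvzW : W.valuation z = 1 := by
      refine le_antisymm ((W.valuation_le_one_iff _).mpr hzW) ?_
      have hzinv : z⁻¹ ∈ W := hOW (by
        rw [← O.valuation_le_one_iff, map_inv₀, hvz, inv_one])
      have h2 : W.valuation z⁻¹ ≤ 1 := (W.valuation_le_one_iff _).mpr hzinv
      rwa [map_inv₀, inv_le_one₀ (pos_iff_ne_zero.mpr ((map_ne_zero _).mpr
        (ne_zero_of_valuation_eq_one hvz)))] at h2
    obtain ⟨h, hdiv, -⟩ := residue_div hyW hzW hvzW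
    have hw' : w = ⟨y / z, h⟩ := Subtype.ext hwe
    refine ⟨residue W ⟨y, hyW⟩, ⟨⟨y, hyW⟩, hy, rfl⟩, residue W ⟨z, hzW⟩, ⟨⟨z, hzW⟩, hz, rfl⟩,
      (residue_valuation_eq_one_iff hOW hO'' (z := ⟨z, hzW⟩) (hC hz)).mpr hvz, ?_⟩
    rw [hw', hdiv]
  · rintro ⟨_, ⟨wy, hwy, rfl⟩, _, ⟨wz, hwz, rfl⟩, hv, rfl⟩
    have hvzO : O.valuation (wz : K) = 1 :=
      (residue_valuation_eq_one_iff hOW hO'' (hC hwz)).mp hv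
    have hvzW : W.valuation (wz : K) = 1 := (residue_ne_zero_iff wz).mp (by
      intro h0; rw [h0, map_zero] at hv; exact zero_ne_one hv)
    obtain ⟨h, hdiv, -⟩ := residue_div wy.2 wz.2 hvzW
    exact ⟨⟨(wy : K) / wz, h⟩, ⟨wy, hwy, wz, hwz, hvzO, rfl⟩, hdiv⟩

include hO'' in
/-- `π(R) ⊆ O''` for `R ⊆ O`. [folklore] -/
theorem residue_le (R : Subring K) (hRO : R ≤ O.toSubring) :
    (R.comap W.subtype).map (residue W) ≤ O''.toSubring := by
  rintro _ ⟨w, hw, rfl⟩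
  rw [hO'']
  exact ⟨w, hRO hw, rfl⟩

/-- The image `π(R)` of a local subring `R ⊆ W` is a local ring, the surjective image of `R`.
[folklore] -/
theorem isLocalRing_residue {R : Subring K} [IsLocalRing R] (hRW : R ≤ W.toSubring) :
    IsLocalRing ((R.comap W.subtype).map (residue W)) := by
  set D : Subring (ResidueField W) := (R.comap W.subtype).map (residue W) with hD
  have hθD : ∀ x : R, (residue W).comp (Subring.inclusion hRW) x ∈ D := fun x => ⟨_, x.2, rfl⟩
  let θ : R →+* D := ((residue W).comp (Subring.inclusion hRW)).codRestrict D hθD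
  have hθ : Function.Surjective θ := by
    rintro ⟨_, w, hw, rfl⟩
    exact ⟨⟨(w : K), hw⟩, Subtype.ext rfl⟩
  exact IsLocalRing.of_surjective' θ hθ

include hOW hO'' in
/-- **Domination passes to the residue field**: if `O` dominates `R` then `O''` dominates `π(R)`.
[folklore] -/
theorem subringDominates_residue {R : Subring K} (hO : SubringDominates R O.toSubring) :
    SubringDominates ((R.comap W.subtype).map (residue W)) O''.toSubring := by
  refine ⟨residue_le hO'' R hO.1, ?_⟩
  rintro _ ⟨w, hw, rfl⟩ hinv
  by_cases h0 : residue W w = 0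
  · rw [h0, inv_zero]; exact Subring.zero_mem _
  have hwO : (w : K) ∈ O := hO.1 hw
  have hmem : residue W w ∈ O'' := residue_mem hO'' hwO
  -- `π(w)` is a unit of `O''`, so `w` is a unit of `O`, so `w⁻¹ ∈ R`
  have h1 : O''.valuation (residue W w) = 1 := by
    refine le_antisymm ((O''.valuation_le_one_iff _).mpr hmem) ?_
    have h2 : O''.valuation (residue W w)⁻¹ ≤ 1 := (O''.valuation_le_one_iff _).mpr hinv
    rwa [map_inv₀, inv_le_one₀ (pos_iff_ne_zero.mpr ((map_ne_zero _).mpr h0))] at h2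
  have hwv : O.valuation (w : K) = 1 := (residue_valuation_eq_one_iff hOW hO'' hwO).mp h1
  have hw0 : (w : K) ≠ 0 := ne_zero_of_valuation_eq_one hwv
  have hwinvO : (w : K)⁻¹ ∈ O := by rw [← O.valuation_le_one_iff, map_inv₀, hwv, inv_one]
  have hwinvR : (w : K)⁻¹ ∈ R := hO.2 _ hw hwinvO
  have hmul : w * ⟨(w : K)⁻¹, hOW hwinvO⟩ = 1 := Subtype.ext (mul_inv_cancel₀ hw0)
  have e : (residue W w)⁻¹ = residue W ⟨(w : K)⁻¹, hOW hwinvO⟩ :=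
    inv_eq_of_mul_eq_one_right (by rw [← map_mul (residue W), hmul, map_one])
  rw [e]
  exact ⟨_, hwinvR, rfl⟩

/-- **`π(R)` is a local ring of `κ(W)`** when `R ⊆ W` is local and every element of `W` is a
fraction `a/s` of elements of `R` with `w(s) = 0` (i.e. `W = R_{𝔪_W ∩ R}`). [folklore] -/
theorem isLocalRingOf_residue {R : Subring K} [IsLocalRing R] (hRW : R ≤ W.toSubring)
    (hfrac : ∀ z ∈ W, ∃ a ∈ R, ∃ s ∈ R, ¬ W.valuation s < 1 ∧ z = a / s) :
    IsLocalRingOf ((R.comap W.subtype).map (residue W)) := by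
  refine ⟨isLocalRing_residue hRW, fun ℓ => ?_⟩
  obtain ⟨w, rfl⟩ := IsLocalRing.residue_surjective ℓ
  obtain ⟨a, ha, s, hs, hvs, hwe⟩ := hfrac w w.2
  have hvs1 : W.valuation s = 1 := le_antisymm ((W.valuation_le_one_iff _).mpr (hRW hs)) (not_lt.mp hvs)
  obtain ⟨h, hdiv, hs0⟩ := residue_div (hRW ha) (hRW hs) hvs1
  have hw' : w = ⟨a / s, h⟩ := Subtype.ext hwe
  exact ⟨_, ⟨⟨a, hRW ha⟩, ha, rfl⟩, _, ⟨⟨s, hRW hs⟩, hs, rfl⟩, hs0, by rw [hw', hdiv]⟩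

/-- `π(R)` is Noetherian when `R` is. [folklore] -/
theorem isNoetherianRing_residue {R : Subring K} [IsNoetherianRing R] (hRW : R ≤ W.toSubring) :
    IsNoetherianRing ((R.comap W.subtype).map (residue W)) := by
  set D : Subring (ResidueField W) := (R.comap W.subtype).map (residue W) with hD
  have hθD : ∀ x : R, (residue W).comp (Subring.inclusion hRW) x ∈ D := fun x => ⟨_, x.2, rfl⟩
  let θ : R →+* D := ((residue W).comp (Subring.inclusion hRW)).codRestrict D hθD
  have hθ : Function.Surjective θ := by
    rintro ⟨_, w, hw, rfl⟩
    exact ⟨⟨(w : K), hw⟩, Subtype.ext rfl⟩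
  exact isNoetherianRing_of_surjective R D θ hθ

/-- **`dim π(R) ≤ dim R - 1`** when some `0 ≠ q ∈ R` has `w(q) > 0`: `π(R)` is a quotient of
`R/(q)`. Stated for `dim R = 2`: `dim π(R) ≤ 1`. [folklore] -/
theorem ringKrullDim_residue_le_one {R : Subring K} (hRW : R ≤ W.toSubring)
    (hdim : ringKrullDim R = 2) {q : K} (hqR : q ∈ R) (hq0 : q ≠ 0) (hqW : W.valuation q < 1) :
    ringKrullDim ((R.comap W.subtype).map (residue W)) ≤ 1 := by
  set D : Subring (ResidueField W) := (R.comap W.subtype).map (residue W) with hD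
  have hθD : ∀ x : R, (residue W).comp (Subring.inclusion hRW) x ∈ D := fun x => ⟨_, x.2, rfl⟩
  let θ : R →+* D := ((residue W).comp (Subring.inclusion hRW)).codRestrict D hθD
  have hθ : Function.Surjective θ := by
    rintro ⟨_, w, hw, rfl⟩
    exact ⟨⟨(w : K), hw⟩, Subtype.ext rfl⟩
  -- `θ` kills `q`, so factors through `R/(q)`
  have hθq : ∀ a ∈ Ideal.span {(⟨q, hqR⟩ : R)}, θ a = 0 := by
    intro a ha
    obtain ⟨c, rfl⟩ := Ideal.mem_span_singleton'.mp ha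
    rw [map_mul]
    suffices h0 : θ ⟨q, hqR⟩ = 0 by rw [h0, mul_zero]
    apply Subtype.ext
    change residue W (Subring.inclusion hRW ⟨q, hqR⟩) = 0
    rw [IsLocalRing.residue_eq_zero_iff, ValuationSubring.valuation_lt_one_iff]
    exact hqW
  let g : R ⧸ Ideal.span {(⟨q, hqR⟩ : R)} →+* D := Ideal.Quotient.lift _ θ hθq
  have hg : Function.Surjective g := by
    intro d
    obtain ⟨a, rfl⟩ := hθ d
    exact ⟨Ideal.Quotient.mk _ a, Ideal.Quotient.lift_mk _ _ _⟩
  have h1 : ringKrullDim D ≤ ringKrullDim (R ⧸ Ideal.span {(⟨q, hqR⟩ : R)}) :=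
    ringKrullDim_le_of_surjective g hg
  have hq0' : (⟨q, hqR⟩ : R) ≠ 0 := fun h => hq0 (congrArg Subtype.val h)
  have h2 : ringKrullDim (R ⧸ Ideal.span {(⟨q, hqR⟩ : R)}) + 1 ≤ ringKrullDim R :=
    ringKrullDim_quotient_succ_le_of_nonZeroDivisor (mem_nonZeroDivisors_of_ne_zero hq0')
  rw [hdim, ← one_add_one_eq_two] at h2
  exact h1.trans (ENat.WithBot.add_le_add_one_right_iff.mp h2)

end Image

end Summit.ResolutionOfSingularities.ResolutionOfSingularities.Theorems.PfaffLine.CurveMono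

namespace Summit.ResolutionOfSingularities.ResolutionOfSingularities.Theorems.PfaffLine

/-- **Registered sub-goal `curveMono_residue_locAtCentre`** (universe `0`, for `--supports`
registration): the residue map of a coarsening `W ⊇ O` commutes with localising at the centre.
[folklore] -/
theorem curveMono_residue_locAtCentre : ∀ {K : Type} [Field K] {O W : ValuationSubring K}, O ≤ W → ∀ {O'' : ValuationSubring (IsLocalRing.ResidueField W)}, O''.toSubring = (O.toSubring.comap W.subtype).map (IsLocalRing.residue W) → ∀ {C : Subring K}, C ≤ O.toSubring → ((Literature.AlgebraicGeometry.Resolution.locAtCentre C O).comap W.subtype).map (IsLocalRing.residue W) = Literature.AlgebraicGeometry.Resolution.locAtCentre ((C.comap W.subtype).map (IsLocalRing.residue W)) O'' := by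
  intro K _ O W hOW O'' hO'' C hC
  exact CurveMono.residue_locAtCentre hOW hO'' hC

end Summit.ResolutionOfSingularities.ResolutionOfSingularities.Theorems.PfaffLine
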